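import Summits.QuantumFields.YangMills.Theorems.BalabanUVNodesN22AtRecordAnalytic
import Summits.QuantumFields.BalabanUV.T4Continuum.Spine.NE1p.DressedOutputAnalyticFaces

/-!
# BalabanUVNodes ∕ node N22 = NE9 — THE ACTIVITY-STRIP SLOT: ROAD 3's analyticity letter (A) PRODUCED from a cluster representation of the
# young-coupling sections on the torus catalogue of the papers (`tsys 4 N`, `TTouch`, `torusTreeLen`) with activities holomorphic in the
# complexified coupling under ONE (2.38)-type majorant — Kotecký–Preiss holomorphy + the (2.41) bound (S25 BY NAME), then `S_N22` by n22-a's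
# ROAD-3 closers BY NAME; the tower form with node N18 below the level

Cell `pub-ymgap`, HUMAN RULING D-0062 (Track A), R134 fan-out seat `pub-ymgap-dag-n22-c` (strategy s1: «the history-Lipschitz estimate
(2.40)–(2.41) p. 21 of [II] on the W1 object»), generation 0.  THEOREMS ONLY (no `def`, no `def … : Prop`); imports n22-a's ROAD-3 at-record
closers `…Theorems.BalabanUVNodesN22AtRecordAnalytic` (p421057 + v1.1 p425325: `n22At_of_oscAnalytic`, `n22At_level_of_n18At_below_analytic`)
and the NE1′ crew's torus face `Summits.QuantumFields.BalabanUV.T4Continuum.Spine.NE1p.DressedOutputAnalyticFaces` (S25: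
`analytic_and_bounded_locE_param_torus`) BY NAME.  `--supports stmt-QuantumFields-19676` (K3 `SpineGivenEndpointR11`).

WHY THIS FILE (located, bus «DAGN22C-G0-LOCATED-1» 2026-08-26).  The estimate side of [II] (2.39)–(2.41) is kernel in every currency of the tree —
one run as printed (`B13Eq240Printed`, `B13Ineq240`, `B13Resummation.norm_locE_le_of_small`, torus `B14Eq347Torus.norm_locE_torus_le`, S24∕S25),
two histories (`T4ActivityLipschitz.norm_locE_sub_locE_le{,_of_small,_of_pencil_small}`), holomorphy in a parameter
(`B13LocEAnalytic.differentiableOn_locE_param_of_kp`) — and every `S_N22` closer of record (`YMDAG.N22.s_N22_of_oscSecondDiff ∕ _of_towerSlot ∕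
_of_oscAnalytic ∕ _of_oscStrip …`) takes its regularity letter at the OUTPUT level, on the young-coupling sections of the bundle's functional
`EA`; the desk census `N22-ROADS-CENSUS.md` v1.4 marks that letter «localized = W1» in every road.  This file moves the letter ONE LEVEL DOWN, to
where the W1 OBJECT (definer seat `node00-def-W1`: [II] (2.13)–(2.14) on the torus catalogue) and node N10's activity bound (Lemma 3 (2.38))
meet: an ACTIVITY-STRIP SLOT — for every window history `g`, background `U`, domain `X` and young coupling `i < scale X`, a torus domain `X₀`
reading `X` (`κ·d(X) ≤ r₁·d(X₀)`), an open set `O ⊇` the closed `r`-discs about `]0, γ]`, and a complexified ACTIVITY family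
`Hc : ℂ → 𝐃 → ℂ`, holomorphic on `O` polymer by polymer inside `X₀`, dominated on `O` by ONE majorant `A·e^{−R·d(Z)}`, whose cluster sum
`Σ_{∪𝒞 = X₀} Φ^T(𝒞; Hc t)` (`B13Resummation.locE`, the Kotecký–Preiss form of (2.13)) has REAL PART the section `t ↦ EA (g | g_i := t) U X` on
`]0, γ]` (the W1 object's shape: `T4OutputRate.Functional` := `(complex cluster sum).re`, definer seat `node00-def-W1` INTENT 2026-08-26).
Under the two LOCATED numerals of S25 («κ sufficiently large» `r₁ + 2·64·log 162 + 2 ≤ R`, «ε₁ sufficiently small» `A·e^{5r₁+1}·K₀(64,8)·9·64 ≤ 1`)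
the slot yields the (A) letter with `M = e·9·64·K₀(64,8)²·A` and NO growth (`μ = 1`) — §1 — hence `N22At` ∕ `S_N22 RRec` on ROAD 3 at every rate
`θ^{1−s}` above node N18's `θ` — §2 — and the tower form — §3.

WHAT.
* §0 `exists_holo_extension_of_re` — engine (one-variable complex analysis): a holomorphic `F` on an open set containing the closed `r`-discs
  about a real set, bounded by `B`, whose real part on that set is `f`, yields the HOLOMORPHIC EXTENSION `G = (F + conj ∘ F ∘ conj)∕2` of `f`
  with the same bound on the reflection-symmetric part (Schwarz symmetrisation) — so no reality lemma on the activities is needed.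
* §1 `supLetter_of_activityStrip` — over abstract `T4OutputRate.Carriers` ∕ `Functional`: the activity-strip slot ⇒ the (A) sup letter of
  `n22At_of_oscAnalytic` ∕ `N22KnitTwoConstants.ne9_and_fadingMemory_of_osc_analytic_rpow` with `M = e·9·64·K₀(64,8)²·A`, `μ = 1` (S25 BY NAME +
  monotonicity of `exp` + §0).
* §2 `n22At_of_oscActivityStrip` — (P) + (O) at the bundle's NE5 rate `θ` + the activity-strip slot ⇒ `N22At u` with `ω = θ^{1−s}`,
  `Λ k i = C₉·ω^{k−i}`, `C₉ = (32∕(s²·min(r∕2, γ∕2)))·C₀^{1−s}(2M)^{s}∕ω`; `s_N22_of_oscActivityStrip` — `S_N22 RRec` for EVERY `RRec` whose bundles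
  carry the slot (refinement-generic).
* §3 `n22At_level_of_n18At_below_activityStrip` — the tower form: node N18 BY NAME at the levels `k′ < k` + (P) + the activity-strip slot at
  level `k` ⇒ `N22At` of the level bundle; `s_N22_of_towerSlot_activityStrip`.

HONEST FRAMING.  Count-neutral by-name knit (S25 ∘ n22-a's ROAD-3 closers); NOT a discharge of N22; no `RRec` home exists (R422 (A)(P2)).  The
activity-strip slot is a DISPLAYED hypothesis: its representation clause is the W1 object (seat `node00-def-W1`), its holomorphy-under-one-majorant
clause is [II] Lemma 3 (2.38) for activities complexified in an OLDER coupling — the printed TYPE *"(or analytic)"* is stated for the LAST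
coupling only ([I] p. 263) — i.e. node N10's T-row read on a strip, asserted nowhere here; (O) = node N18.  NE5 ∕ NE9 NOT IN PRINT, NOT PROVED;
instance on Bałaban's localized `E^{(j)}(X)` 0∕1; one finite four-torus programme at fixed ε — NOT infinite volume, NOT OS on ℝ⁴, NOT a mass
gap, NOT Clay.  0 `sorry`, 0 `def`, standard axioms.

References (TYPES only): [I] = [Balaban1987RG1] T. Bałaban, Commun. Math. Phys. **109** (1987) 249–301 — p. 263 *"It is a C^∞-function of
g_{j−1} ∈ [0, γ], (or analytic)"*, (1.18); [II] = [Balaban1988RG2Cluster] T. Bałaban, Commun. Math. Phys. **116** (1988) 1–22 — (2.13)–(2.14)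
pp. 14–15, p. 15 *"Thus the activities in (2.13), and the whole sum E^{(k+1)}(X), are analytic functions of (U, J)"*, Lemma 3 (2.38) p. 20,
(2.39)–(2.41) p. 21; [KoteckyPreiss1986] Thm p. 492.
-/

noncomputable section

namespace YMDAG.N22

open Set Metric
open scoped BigOperators ComplexConjugate
open Literature.MathematicalPhysics.QuantumFieldTheory.Balaban1983to89
open Literature.MathematicalPhysics.QuantumFieldTheory.Balaban1983to89.T4Continuum
open Literature.MathematicalPhysics.QuantumFieldTheory.Balaban1983to89.T4OutputRate
open Literature.MathematicalPhysics.QuantumFieldTheory.Balaban1983to89.B13Resummation (locE)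
open Literature.MathematicalPhysics.QuantumFieldTheory.Balaban1983to89.TreeLengthTorus (TPt TDom tsys torusTreeLen)
open Literature.MathematicalPhysics.QuantumFieldTheory.Balaban1983to89.TreeLengthTorusGeometry (TTouch)
open Literature.MathematicalPhysics.QuantumFieldTheory.Balaban1983to89.B12TreeDecay (K₀)
open Summit.QuantumFields.BalabanUV.T4Continuum.NE9.TowerCarriers (TowerData prepend)
open Summit.QuantumFields.BalabanUV.T4Continuum.NE1p.DressedOutputAnalyticFaces (analytic_and_bounded_locE_param_torus)
open YMDAG.UVSplit

/-! ## §0 Engine: a holomorphic function whose REAL PART on the real window is the section extends the section (Schwarz symmetrisation) -/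

/-- **SCHWARZ SYMMETRISATION** (engine, pure one-variable complex analysis).  If `F` is holomorphic on an open `O ⊆ ℂ` containing the closed
`r`-discs about the real points of `S`, bounded by `B` on `O`, and its REAL PART at the real points `t ∈ S` is `f t`, then the symmetrised function
`G z = (F z + conj (F (conj z)))∕2` is holomorphic on the reflection-symmetric open part `O ∩ conj⁻¹ O ⊇` the same closed discs, bounded by `B` there,
and EXTENDS `f`: `G t = f t` for `t ∈ S` (`z + conj z = 2 Re z`).  This is what lets a cluster representation of the REAL functional as the real
part of a complex cluster sum (`T4OutputRate.Functional` = `(…).re`, the W1 object's shape) feed ROAD 3's letter, with no reality lemma on the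
activities. [folklore] -/
theorem exists_holo_extension_of_re {F : ℂ → ℂ} {O : Set ℂ} {S : Set ℝ} {f : ℝ → ℝ} {r B : ℝ} (hO : IsOpen O)
    (hF : DifferentiableOn ℂ F O) (hB : ∀ z ∈ O, ‖F z‖ ≤ B) (hdisc : ∀ t ∈ S, closedBall (t : ℂ) r ⊆ O)
    (hre : ∀ t ∈ S, (F t).re = f t) :
    ∃ (G : ℂ → ℂ) (Dset : Set ℂ), DifferentiableOn ℂ G Dset ∧ (∀ z ∈ Dset, ‖G z‖ ≤ B) ∧
      (∀ t ∈ S, closedBall (t : ℂ) r ⊆ Dset) ∧ (∀ t ∈ S, G t = (f t : ℂ)) := by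
  refine ⟨fun z => (F z + (starRingEnd ℂ ∘ F ∘ starRingEnd ℂ) z) / 2, O ∩ {z | starRingEnd ℂ z ∈ O}, ?_, ?_, ?_, ?_⟩
  · intro z hz
    have h1 : DifferentiableAt ℂ F z := hF.differentiableAt (hO.mem_nhds hz.1)
    have h2 : DifferentiableAt ℂ (starRingEnd ℂ ∘ F ∘ starRingEnd ℂ) z :=
      differentiableAt_conj_conj_iff.2 (hF.differentiableAt (hO.mem_nhds hz.2))
    exact ((h1.add h2).div_const 2).differentiableWithinAt
  · intro z hz
    have h1 : ‖F z‖ ≤ B := hB z hz.1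
    have h2 : ‖(starRingEnd ℂ ∘ F ∘ starRingEnd ℂ) z‖ ≤ B := by
      simp only [Function.comp_apply, Complex.norm_conj]
      exact hB _ hz.2
    calc ‖(F z + (starRingEnd ℂ ∘ F ∘ starRingEnd ℂ) z) / 2‖ = ‖F z + (starRingEnd ℂ ∘ F ∘ starRingEnd ℂ) z‖ / 2 := by
          rw [norm_div, Complex.norm_two]
      _ ≤ (‖F z‖ + ‖(starRingEnd ℂ ∘ F ∘ starRingEnd ℂ) z‖) / 2 := by gcongr; exact norm_add_le _ _
      _ ≤ (B + B) / 2 := by gcongr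
      _ = B := by ring
  · intro t ht w hw
    refine ⟨hdisc t ht hw, hdisc t ht ?_⟩
    rw [mem_closedBall, Complex.dist_eq] at hw ⊢
    have : starRingEnd ℂ w - (t : ℂ) = starRingEnd ℂ (w - (t : ℂ)) := by rw [map_sub, Complex.conj_ofReal]
    rw [this, Complex.norm_conj]
    exact hw
  · intro t ht
    simp only [Function.comp_apply, Complex.conj_ofReal]
    rw [Complex.add_conj, ← hre t ht]
    push_cast
    ring

/-! ## §1 The activity-strip slot yields ROAD 3's sup letter (A) with `μ = 1` -/

open Classical in
/-- **THE ACTIVITY-STRIP SLOT ⟹ THE (A) LETTER, NO GROWTH.**  Over abstract carriers `C` and a functional `E`, with a torus side `Nsz j` per scale: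
IF for every window history `g ∈ Window γ`, background `U`, domain `X` and young coupling `i < scale X` there are a torus domain
`X₀ : 𝐃(T_{Nsz (scale X)})` reading `X` (`κ·d(X) ≤ r₁·d(X₀)`), an open `O ⊆ ℂ` containing the closed `r`-discs about `]0, γ]`, and a complexified
activity family `Hc : ℂ → 𝐃 → ℂ` — holomorphic on `O` polymer by polymer inside `X₀`, dominated on `O` by the ONE majorant `A·e^{−R·d(Z)}` ((2.38)
TYPE), and whose Kotecký–Preiss cluster sum localized at `X₀` ((2.13), `B13Resummation.locE` on `TTouch`) has REAL PART the section
`EA (g | g_i := t) U X` for `t ∈ ]0, γ]` — THEN, under S25's located numerals `r₁ + 2·64·log 162 + 2 ≤ R` and `A·e^{5r₁+1}·K₀(64,8)·9·64 ≤ 1`, every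
young-coupling section extends to a function holomorphic on a set containing the closed `r`-discs about `]0, γ]` and bounded there by
`(e·9·64·K₀(64,8)²·A)·1^{age}·e^{−κd(X)}` — literally the `hA` clause of `YMDAG.N22.n22At_of_oscAnalytic` with `μ = 1` (S25
`analytic_and_bounded_locE_param_torus` BY NAME, then §0). [folklore] -/
theorem supLetter_of_activityStrip {C : Carriers} {Bg : Type} {E : Functional C Bg} (Nsz : ℕ → ℕ) [∀ j, NeZero (Nsz j)]
    {γ κ A R r₁ r : ℝ} (hA0 : 0 ≤ A) (hr₁ : 0 ≤ r₁) (hrate : r₁ + 2 * (64 * Real.log 162) + 2 ≤ R)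
    (hsmall : A * Real.exp (5 * r₁ + 1) * K₀ 64 8 * 9 * 64 ≤ 1)
    (hAct : ∀ g ∈ Window γ, ∀ (U : Bg) (X : C.Dom) (i : ℕ), i < C.scale X →
      ∃ (X₀ : (tsys 4 (Nsz (C.scale X))).Dom) (Hc : ℂ → (tsys 4 (Nsz (C.scale X))).Dom → ℂ) (O : Set ℂ),
        IsOpen O ∧ (∀ t ∈ Ioc (0 : ℝ) γ, closedBall (t : ℂ) r ⊆ O) ∧
        (∀ Z : (tsys 4 (Nsz (C.scale X))).Dom, Z.1 ⊆ X₀.1 → DifferentiableOn ℂ (fun z => Hc z Z) O) ∧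
        (∀ z ∈ O, ∀ Z : (tsys 4 (Nsz (C.scale X))).Dom, Z.1 ⊆ X₀.1 → ‖Hc z Z‖ ≤ A * Real.exp (-(R * torusTreeLen Z.1))) ∧
        κ * C.d X ≤ r₁ * torusTreeLen X₀.1 ∧
        (∀ t ∈ Ioc (0 : ℝ) γ,
          (locE (TTouch (d := 4) (N := Nsz (C.scale X))) (fun Z : (tsys 4 (Nsz (C.scale X))).Dom => Z.1) (Hc t) X₀.1).re =
            E (Function.update g i t) U X)) :
    ∀ g ∈ Window γ, ∀ (U : Bg) (X : C.Dom) (i : ℕ), i < C.scale X → ∃ (F : ℂ → ℂ) (Dset : Set ℂ),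
      DifferentiableOn ℂ F Dset ∧
      (∀ z ∈ Dset, ‖F z‖ ≤ Real.exp 1 * 9 * 64 * K₀ 64 8 ^ 2 * A * 1 ^ (C.scale X - 1 - i) * Real.exp (-(κ * C.d X))) ∧
      (∀ t ∈ Ioc (0 : ℝ) γ, closedBall (t : ℂ) r ⊆ Dset) ∧ (∀ t ∈ Ioc (0 : ℝ) γ, F t = (E (Function.update g i t) U X : ℂ)) := by
  intro g hg U X i hi
  obtain ⟨X₀, Hc, O, hO, hdisc, hhol, hmaj, hcmp, hrep⟩ := hAct g hg U X i hi
  have key := analytic_and_bounded_locE_param_torus (N := Nsz (C.scale X)) (P := ℂ)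
    (m := fun Z : (tsys 4 (Nsz (C.scale X))).Dom => A * Real.exp (-(R * torusTreeLen Z.1))) (act := Hc) (A := A) (R := R)
    (r₁ := r₁) X₀ hO hA0 hr₁ hrate hsmall hhol (fun z hz Z hZ => hmaj z hz Z hZ) (fun Z _ => le_rfl)
  have hM : 0 ≤ Real.exp 1 * 9 * 64 * K₀ 64 8 ^ 2 * A := by positivity
  have hB : ∀ z ∈ O, ‖locE (TTouch (d := 4) (N := Nsz (C.scale X))) (fun Z : (tsys 4 (Nsz (C.scale X))).Dom => Z.1) (Hc z) X₀.1‖ ≤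
      Real.exp 1 * 9 * 64 * K₀ 64 8 ^ 2 * A * 1 ^ (C.scale X - 1 - i) * Real.exp (-(κ * C.d X)) := by
    intro z hz
    calc ‖locE (TTouch (d := 4) (N := Nsz (C.scale X))) (fun Z : (tsys 4 (Nsz (C.scale X))).Dom => Z.1) (Hc z) X₀.1‖
        ≤ Real.exp 1 * 9 * 64 * K₀ 64 8 ^ 2 * A * Real.exp (-(r₁ * torusTreeLen X₀.1)) := key.2 z hz
      _ ≤ Real.exp 1 * 9 * 64 * K₀ 64 8 ^ 2 * A * Real.exp (-(κ * C.d X)) :=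
          mul_le_mul_of_nonneg_left (Real.exp_le_exp.2 (neg_le_neg hcmp)) hM
      _ = Real.exp 1 * 9 * 64 * K₀ 64 8 ^ 2 * A * 1 ^ (C.scale X - 1 - i) * Real.exp (-(κ * C.d X)) := by
          rw [one_pow, mul_one]
  exact exists_holo_extension_of_re (f := fun t => E (Function.update g i t) U X) hO key.1 hB hdisc hrep

/-! ## §2 The activity-strip slot carries `N22At`; `S_N22` for every `RRec` carrying it -/

variable {N : ℕ} [NeZero N]

open Classical in
/-- **THE ACTIVITY-STRIP SLOT CARRIES `N22At` (ROAD 3, rate `θ^{1−s}`).**  A U3 bundle with window `Window γ`, (P) prefix dependence, (O) oscillation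
fading with constant `C₀ > 0` at the bundle's NE5 rate `0 < θ ≤ 1`, the activity-strip slot of §1 (torus sides `Nsz`, majorant `A·e^{−R·d}`, decay
transfer `r₁`, margin `r`, S25's two numerals, `C₀ ≤ 2M` for `M = e·9·64·K₀(64,8)²·A`), a parameter `0 < s < 1` and the letters `ω = θ^{1−s}`,
`Λ k i = C₉·ω^{k−i}`, `C₉ = (32∕(s²·min(r∕2, γ∕2)))·C₀^{1−s}(2M)^{s}∕ω` carries `N22At` — §1 then `n22At_of_oscAnalytic` at `μ = 1` BY NAME. [folklore] -/
theorem n22At_of_oscActivityStrip (u : U3Carriers) (Nsz : ℕ → ℕ) [∀ j, NeZero (Nsz j)] {C₀ A R r₁ r s : ℝ}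
    (hW : u.W = Window u.γ) (hP : PrefixDependenceOn u.EA (Window u.γ))
    (hO : ∀ g ∈ Window u.γ, ∀ g' ∈ Window u.γ, ∀ (U : u.C.BgA) (X : u.C.Dom) (a : ℕ), a ≤ u.C.scale X →
      (∀ n, a ≤ n → g n = g' n) → |u.EA g U X - u.EA g' U X| ≤ C₀ * u.θ ^ (u.C.scale X - a) * Real.exp (-(u.κ * u.C.d X)))
    (hAct : ∀ g ∈ Window u.γ, ∀ (U : u.C.BgA) (X : u.C.Dom) (i : ℕ), i < u.C.scale X →
      ∃ (X₀ : (tsys 4 (Nsz (u.C.scale X))).Dom) (Hc : ℂ → (tsys 4 (Nsz (u.C.scale X))).Dom → ℂ) (O : Set ℂ),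
        IsOpen O ∧ (∀ t ∈ Ioc (0 : ℝ) u.γ, closedBall (t : ℂ) r ⊆ O) ∧
        (∀ Z : (tsys 4 (Nsz (u.C.scale X))).Dom, Z.1 ⊆ X₀.1 → DifferentiableOn ℂ (fun z => Hc z Z) O) ∧
        (∀ z ∈ O, ∀ Z : (tsys 4 (Nsz (u.C.scale X))).Dom, Z.1 ⊆ X₀.1 → ‖Hc z Z‖ ≤ A * Real.exp (-(R * torusTreeLen Z.1))) ∧
        u.κ * u.C.d X ≤ r₁ * torusTreeLen X₀.1 ∧
        (∀ t ∈ Ioc (0 : ℝ) u.γ,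
          (locE (TTouch (d := 4) (N := Nsz (u.C.scale X))) (fun Z : (tsys 4 (Nsz (u.C.scale X))).Dom => Z.1) (Hc t) X₀.1).re =
            u.EA (Function.update g i t) U X))
    (hA0 : 0 < A) (hr₁ : 0 ≤ r₁) (hrate : r₁ + 2 * (64 * Real.log 162) + 2 ≤ R)
    (hsmall : A * Real.exp (5 * r₁ + 1) * K₀ 64 8 * 9 * 64 ≤ 1)
    (hC₀ : 0 < C₀) (hθ : 0 < u.θ) (hθ1 : u.θ ≤ 1) (hCM : C₀ ≤ 2 * (Real.exp 1 * 9 * 64 * K₀ 64 8 ^ 2 * A)) (hr : 0 < r)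
    (hγ : 0 < u.γ) (hs0 : 0 < s) (hs1 : s < 1)
    (hω : u.ω = u.θ ^ (1 - s)) (hΛ : u.Λ = fun k i => u.C₉ * u.ω ^ (k - i))
    (hC₉ : u.C₉ = 32 / (s ^ 2 * min (r / 2) (u.γ / 2)) * (C₀ ^ (1 - s) * (2 * (Real.exp 1 * 9 * 64 * K₀ 64 8 ^ 2 * A)) ^ s) /
      u.θ ^ (1 - s)) :
    N22At u := by
  have hA := supLetter_of_activityStrip (E := u.EA) Nsz hA0.le hr₁ hrate hsmall hAct
  have hM : 0 < Real.exp 1 * 9 * 64 * K₀ 64 8 ^ 2 * A := by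
    have hK : 0 < K₀ 64 8 := B12TreeDecay.K₀_pos 64 8
    positivity
  have hω' : u.ω = u.θ ^ (1 - s) * (1 : ℝ) ^ s := by rw [Real.one_rpow, mul_one]; exact hω
  have hC₉' : u.C₉ = 32 / (s ^ 2 * min (r / 2) (u.γ / 2)) * (C₀ ^ (1 - s) * (2 * (Real.exp 1 * 9 * 64 * K₀ 64 8 ^ 2 * A)) ^ s) /
      (u.θ ^ (1 - s) * (1 : ℝ) ^ s) := by rw [Real.one_rpow, mul_one]; exact hC₉
  exact n22At_of_oscAnalytic u hW hP hO hA hC₀ hθ hM hθ1 hCM hr hγ hs0 hs1 hω' hΛ hC₉'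

open Classical in
/-- **`S_N22 RRec` FOR EVERY `RRec` WHOSE BUNDLES CARRY THE ACTIVITY-STRIP SLOT** (refinement-generic; combine with `YMDAG.N22.s_N22_of_refines`).
The torus sides `Nsz` are allowed to depend on the record's string `(F, D, g₀, os)`. [folklore] -/
theorem s_N22_of_oscActivityStrip (RRec : RateRecordPred N)
    (hslot : ∀ (F : T4Family) (D : Datum F N) (g₀ : ℕ → ℝ) (os : List (ULoop F)) (R : RateCarriers N), RRec F D g₀ os R →
      ∃ (Nsz : ℕ → ℕ) (_ : ∀ j, NeZero (Nsz j)) (C₀ A Rr r₁ r s : ℝ),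
        R.u3.W = Window R.u3.γ ∧ PrefixDependenceOn R.u3.EA (Window R.u3.γ) ∧
        (∀ g ∈ Window R.u3.γ, ∀ g' ∈ Window R.u3.γ, ∀ (U : R.u3.C.BgA) (X : R.u3.C.Dom) (a : ℕ), a ≤ R.u3.C.scale X →
          (∀ n, a ≤ n → g n = g' n) →
            |R.u3.EA g U X - R.u3.EA g' U X| ≤ C₀ * R.u3.θ ^ (R.u3.C.scale X - a) * Real.exp (-(R.u3.κ * R.u3.C.d X))) ∧
        (∀ g ∈ Window R.u3.γ, ∀ (U : R.u3.C.BgA) (X : R.u3.C.Dom) (i : ℕ), i < R.u3.C.scale X →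
          ∃ (X₀ : (tsys 4 (Nsz (R.u3.C.scale X))).Dom) (Hc : ℂ → (tsys 4 (Nsz (R.u3.C.scale X))).Dom → ℂ) (O : Set ℂ),
            IsOpen O ∧ (∀ t ∈ Ioc (0 : ℝ) R.u3.γ, closedBall (t : ℂ) r ⊆ O) ∧
            (∀ Z : (tsys 4 (Nsz (R.u3.C.scale X))).Dom, Z.1 ⊆ X₀.1 → DifferentiableOn ℂ (fun z => Hc z Z) O) ∧
            (∀ z ∈ O, ∀ Z : (tsys 4 (Nsz (R.u3.C.scale X))).Dom, Z.1 ⊆ X₀.1 →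
              ‖Hc z Z‖ ≤ A * Real.exp (-(Rr * torusTreeLen Z.1))) ∧
            R.u3.κ * R.u3.C.d X ≤ r₁ * torusTreeLen X₀.1 ∧
            (∀ t ∈ Ioc (0 : ℝ) R.u3.γ,
              (locE (TTouch (d := 4) (N := Nsz (R.u3.C.scale X))) (fun Z : (tsys 4 (Nsz (R.u3.C.scale X))).Dom => Z.1)
                (Hc t) X₀.1).re = R.u3.EA (Function.update g i t) U X)) ∧
        0 < A ∧ 0 ≤ r₁ ∧ r₁ + 2 * (64 * Real.log 162) + 2 ≤ Rr ∧ A * Real.exp (5 * r₁ + 1) * K₀ 64 8 * 9 * 64 ≤ 1 ∧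
        0 < C₀ ∧ 0 < R.u3.θ ∧ R.u3.θ ≤ 1 ∧ C₀ ≤ 2 * (Real.exp 1 * 9 * 64 * K₀ 64 8 ^ 2 * A) ∧ 0 < r ∧ 0 < R.u3.γ ∧ 0 < s ∧ s < 1 ∧
        R.u3.ω = R.u3.θ ^ (1 - s) ∧ (R.u3.Λ = fun k i => R.u3.C₉ * R.u3.ω ^ (k - i)) ∧
        R.u3.C₉ = 32 / (s ^ 2 * min (r / 2) (R.u3.γ / 2)) * (C₀ ^ (1 - s) * (2 * (Real.exp 1 * 9 * 64 * K₀ 64 8 ^ 2 * A)) ^ s) /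
          R.u3.θ ^ (1 - s)) :
    S_N22 RRec := by
  intro F D g₀ os R hR
  obtain ⟨Nsz, hNsz, C₀, A, Rr, r₁, r, s, hW, hP, hO, hAct, hA0, hr₁, hrate, hsmall, hC₀, hθ, hθ1, hCM, hr, hγ, hs0, hs1, hω, hΛ, hC₉⟩ :=
    hslot F D g₀ os R hR
  haveI := hNsz
  exact n22At_of_oscActivityStrip R.u3 Nsz hW hP hO hAct hA0 hr₁ hrate hsmall hC₀ hθ hθ1 hCM hr hγ hs0 hs1 hω hΛ hC₉

/-! ## §3 The tower form: node N18 below the level + (P) + the activity-strip slot at the level -/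

open Classical in
/-- **THE ACTIVITY-STRIP SLOT ALONG THE TOWER.**  The bundle «level `k` of ne9's tower of carriers» with ROAD 3's letters at `μ = 1`
(`ω = θ^{1−s}·1^{s}`, `Λ a i = C₉·ω^{a−i}`, `C₉ = (32∕(s²·min(r∕2, γ∕2)))·(2C₅∕(1−θ))^{1−s}(2M)^{s}∕ω`, `M = e·9·64·K₀(64,8)²·A`) carries `N22At` as soon as
the bundles «level `k′ < k`» carry `N18At` (node N18 BY NAME; `C₅ > 0`, `0 < θ < 1`), the level functional `E k` has (P), and its young-coupling
sections carry the activity-strip slot of §1 (`2C₅∕(1−θ) ≤ 2M`) — §1 then `n22At_level_of_n18At_below_analytic` at `μ = 1` BY NAME. [folklore] -/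
theorem n22At_level_of_n18At_below_activityStrip (T : TowerData) (E : ℕ → (ℕ → ℝ) → T.B → T.Dom → ℝ) (Nsz : ℕ → ℕ)
    [∀ j, NeZero (Nsz j)] {γ κ θ C₅ A R r₁ r s cr ρ' : ℝ}
    (hC : 0 < C₅) (hθ0 : 0 < θ) (hθ1 : θ < 1) (k : ℕ)
    (h18 : ∀ k' : ℕ, k' < k →
      N18At ⟨T.level k', Window γ, γ, κ, E k', fun b g U X => E (k' + 1) (prepend b g) U X, θ, C₅,
        fun a i => 32 / (s ^ 2 * min (r / 2) (γ / 2)) *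
            ((2 * C₅ / (1 - θ)) ^ (1 - s) * (2 * (Real.exp 1 * 9 * 64 * K₀ 64 8 ^ 2 * A)) ^ s) / (θ ^ (1 - s) * (1 : ℝ) ^ s) *
          (θ ^ (1 - s) * (1 : ℝ) ^ s) ^ (a - i),
        32 / (s ^ 2 * min (r / 2) (γ / 2)) *
          ((2 * C₅ / (1 - θ)) ^ (1 - s) * (2 * (Real.exp 1 * 9 * 64 * K₀ 64 8 ^ 2 * A)) ^ s) / (θ ^ (1 - s) * (1 : ℝ) ^ s),
        θ ^ (1 - s) * (1 : ℝ) ^ s, cr, ρ'⟩)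
    (hP : PrefixDependenceOn (C := T.level k) (E k) (Window γ))
    (hAct : ∀ g ∈ Window γ, ∀ (U : (T.level k).BgA) (X : (T.level k).Dom) (i : ℕ), i < (T.level k).scale X →
      ∃ (X₀ : (tsys 4 (Nsz ((T.level k).scale X))).Dom) (Hc : ℂ → (tsys 4 (Nsz ((T.level k).scale X))).Dom → ℂ) (O : Set ℂ),
        IsOpen O ∧ (∀ t ∈ Ioc (0 : ℝ) γ, closedBall (t : ℂ) r ⊆ O) ∧
        (∀ Z : (tsys 4 (Nsz ((T.level k).scale X))).Dom, Z.1 ⊆ X₀.1 → DifferentiableOn ℂ (fun z => Hc z Z) O) ∧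
        (∀ z ∈ O, ∀ Z : (tsys 4 (Nsz ((T.level k).scale X))).Dom, Z.1 ⊆ X₀.1 → ‖Hc z Z‖ ≤ A * Real.exp (-(R * torusTreeLen Z.1))) ∧
        κ * (T.level k).d X ≤ r₁ * torusTreeLen X₀.1 ∧
        (∀ t ∈ Ioc (0 : ℝ) γ,
          (locE (TTouch (d := 4) (N := Nsz ((T.level k).scale X))) (fun Z : (tsys 4 (Nsz ((T.level k).scale X))).Dom => Z.1)
            (Hc t) X₀.1).re = E k (Function.update g i t) U X))
    (hA0 : 0 < A) (hr₁ : 0 ≤ r₁) (hrate : r₁ + 2 * (64 * Real.log 162) + 2 ≤ R)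
    (hsmall : A * Real.exp (5 * r₁ + 1) * K₀ 64 8 * 9 * 64 ≤ 1)
    (hCM : 2 * C₅ / (1 - θ) ≤ 2 * (Real.exp 1 * 9 * 64 * K₀ 64 8 ^ 2 * A)) (hr : 0 < r) (hγ : 0 < γ) (hs0 : 0 < s) (hs1 : s < 1) :
    N22At ⟨T.level k, Window γ, γ, κ, E k, fun b g U X => E (k + 1) (prepend b g) U X, θ, C₅,
      fun a i => 32 / (s ^ 2 * min (r / 2) (γ / 2)) *
          ((2 * C₅ / (1 - θ)) ^ (1 - s) * (2 * (Real.exp 1 * 9 * 64 * K₀ 64 8 ^ 2 * A)) ^ s) / (θ ^ (1 - s) * (1 : ℝ) ^ s) *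
        (θ ^ (1 - s) * (1 : ℝ) ^ s) ^ (a - i),
      32 / (s ^ 2 * min (r / 2) (γ / 2)) *
        ((2 * C₅ / (1 - θ)) ^ (1 - s) * (2 * (Real.exp 1 * 9 * 64 * K₀ 64 8 ^ 2 * A)) ^ s) / (θ ^ (1 - s) * (1 : ℝ) ^ s),
      θ ^ (1 - s) * (1 : ℝ) ^ s, cr, ρ'⟩ := by
  have hA := supLetter_of_activityStrip (C := T.level k) (E := E k) Nsz hA0.le hr₁ hrate hsmall hAct
  have hM : 0 < Real.exp 1 * 9 * 64 * K₀ 64 8 ^ 2 * A := by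
    have hK : 0 < K₀ 64 8 := B12TreeDecay.K₀_pos 64 8
    positivity
  exact n22At_level_of_n18At_below_analytic T E hC hθ0 hθ1 k h18 hP hA hM hθ1.le hCM hr hγ hs0 hs1

open Classical in
/-- **`S_N22 RRec` FOR EVERY `RRec` WHOSE BUNDLES CARRY THE ACTIVITY-STRIP TOWER SLOT** (refinement-generic; the activity-level twin of
`YMDAG.N22.s_N22_of_towerSlot_analytic`): every bundle of record IS a level `k` of a tower of carriers with the letters of
`n22At_level_of_n18At_below_activityStrip`, node N18 holds at the levels `k′ < k`, the level functional has (P), and its young-coupling sections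
carry the activity-strip slot. [folklore] -/
theorem s_N22_of_towerSlot_activityStrip (RRec : RateRecordPred N)
    (hslot : ∀ (F : T4Family) (D : Datum F N) (g₀ : ℕ → ℝ) (os : List (ULoop F)) (Rc : RateCarriers N), RRec F D g₀ os Rc →
      ∃ (T : TowerData) (E : ℕ → (ℕ → ℝ) → T.B → T.Dom → ℝ) (Nsz : ℕ → ℕ) (_ : ∀ j, NeZero (Nsz j))
        (γ κ θ C₅ A R r₁ r s cr ρ' : ℝ) (k : ℕ),
        Rc.u3 = ⟨T.level k, Window γ, γ, κ, E k, fun b g U X => E (k + 1) (prepend b g) U X, θ, C₅,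
          fun a i => 32 / (s ^ 2 * min (r / 2) (γ / 2)) *
              ((2 * C₅ / (1 - θ)) ^ (1 - s) * (2 * (Real.exp 1 * 9 * 64 * K₀ 64 8 ^ 2 * A)) ^ s) / (θ ^ (1 - s) * (1 : ℝ) ^ s) *
            (θ ^ (1 - s) * (1 : ℝ) ^ s) ^ (a - i),
          32 / (s ^ 2 * min (r / 2) (γ / 2)) *
            ((2 * C₅ / (1 - θ)) ^ (1 - s) * (2 * (Real.exp 1 * 9 * 64 * K₀ 64 8 ^ 2 * A)) ^ s) / (θ ^ (1 - s) * (1 : ℝ) ^ s),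
          θ ^ (1 - s) * (1 : ℝ) ^ s, cr, ρ'⟩ ∧
        0 < C₅ ∧ 0 < θ ∧ θ < 1 ∧
        (∀ k' : ℕ, k' < k →
          N18At ⟨T.level k', Window γ, γ, κ, E k', fun b g U X => E (k' + 1) (prepend b g) U X, θ, C₅,
            fun a i => 32 / (s ^ 2 * min (r / 2) (γ / 2)) *
                ((2 * C₅ / (1 - θ)) ^ (1 - s) * (2 * (Real.exp 1 * 9 * 64 * K₀ 64 8 ^ 2 * A)) ^ s) / (θ ^ (1 - s) * (1 : ℝ) ^ s) *
              (θ ^ (1 - s) * (1 : ℝ) ^ s) ^ (a - i),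
            32 / (s ^ 2 * min (r / 2) (γ / 2)) *
              ((2 * C₅ / (1 - θ)) ^ (1 - s) * (2 * (Real.exp 1 * 9 * 64 * K₀ 64 8 ^ 2 * A)) ^ s) / (θ ^ (1 - s) * (1 : ℝ) ^ s),
            θ ^ (1 - s) * (1 : ℝ) ^ s, cr, ρ'⟩) ∧
        PrefixDependenceOn (C := T.level k) (E k) (Window γ) ∧
        (∀ g ∈ Window γ, ∀ (U : (T.level k).BgA) (X : (T.level k).Dom) (i : ℕ), i < (T.level k).scale X →
          ∃ (X₀ : (tsys 4 (Nsz ((T.level k).scale X))).Dom) (Hc : ℂ → (tsys 4 (Nsz ((T.level k).scale X))).Dom → ℂ) (O : Set ℂ),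
            IsOpen O ∧ (∀ t ∈ Ioc (0 : ℝ) γ, closedBall (t : ℂ) r ⊆ O) ∧
            (∀ Z : (tsys 4 (Nsz ((T.level k).scale X))).Dom, Z.1 ⊆ X₀.1 → DifferentiableOn ℂ (fun z => Hc z Z) O) ∧
            (∀ z ∈ O, ∀ Z : (tsys 4 (Nsz ((T.level k).scale X))).Dom, Z.1 ⊆ X₀.1 →
              ‖Hc z Z‖ ≤ A * Real.exp (-(R * torusTreeLen Z.1))) ∧
            κ * (T.level k).d X ≤ r₁ * torusTreeLen X₀.1 ∧
            (∀ t ∈ Ioc (0 : ℝ) γ,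
              (locE (TTouch (d := 4) (N := Nsz ((T.level k).scale X))) (fun Z : (tsys 4 (Nsz ((T.level k).scale X))).Dom => Z.1)
                  (Hc t) X₀.1).re = E k (Function.update g i t) U X)) ∧
        0 < A ∧ 0 ≤ r₁ ∧ r₁ + 2 * (64 * Real.log 162) + 2 ≤ R ∧ A * Real.exp (5 * r₁ + 1) * K₀ 64 8 * 9 * 64 ≤ 1 ∧
        2 * C₅ / (1 - θ) ≤ 2 * (Real.exp 1 * 9 * 64 * K₀ 64 8 ^ 2 * A) ∧ 0 < r ∧ 0 < γ ∧ 0 < s ∧ s < 1) :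
    S_N22 RRec := by
  intro F D g₀ os Rc hR
  obtain ⟨T, E, Nsz, hNsz, γ, κ, θ, C₅, A, R, r₁, r, s, cr, ρ', k, hu, hC, hθ0, hθ1, h18, hP, hAct, hA0, hr₁, hrate, hsmall, hCM, hr,
    hγ, hs0, hs1⟩ := hslot F D g₀ os Rc hR
  haveI := hNsz
  rw [hu]
  exact n22At_level_of_n18At_below_activityStrip T E Nsz hC hθ0 hθ1 k h18 hP hAct hA0 hr₁ hrate hsmall hCM hr hγ hs0 hs1

end YMDAG.N22

end
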